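import Summits.QuantumFields.BalabanUV.T4Continuum.Spine.NE4.AutonomousScheme
import Literature.MathematicalPhysics.QuantumFieldTheory.Balaban1983to89.T4SpectralRenewal

/-!
# Spine/NE4/AutonomousSchemeStable — (R42) under UNIFORM EXPONENTIAL STABILITY ALONG ADMISSIBLE ORBITS (constant `C`, rate `θ`) instead of
# one-step contraction: the same conclusions with constants `× C`; one-step contraction is the case `C = 1`

Cell `pub-balaban-gaps` (YM blitz G2), seat `ne4`, generation 9 (unit `pub-balaban-gaps-ne4-g9`); record `HOME/ne/NE4.md` §5 (R42)(e).
HONEST FRAMING as in `AutonomousScheme`: hypothesis shapes about an ABSTRACT one-step map + elementary metric bookkeeping; NE4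
(`T4CouplingMatching.ScaleShiftRate`, NOT IN PRINT — [Balaban1987RG1] = CMP **109** p. 264) is NOT proved; nothing of Bałaban's is asserted; no status
word moves.  One finite T⁴; NOT ℝ⁴, NOT infinite volume, NOT a mass gap, NOT Clay.

THE POINT.  `AutonomousScheme` asks the k-independent step to CONTRACT IN ONE STEP (`Markov.StateContraction A S θ γ`) in the given metric.  For a
renormalization map whose printed bounds carry O(1) constants this is the wrong currency — exactly as, one level down, `T4SpectralRenewal` records that
a PER-STEP norm bound is the wrong form of the memory input and the COCYCLE bound `‖T_{i+n−1}⋯T_i‖ ≤ Cθ^n` the right one (there for the linearised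
transfer; its §4 hazard shows per-step spectral data do not even suffice).  The nonlinear, autonomous analogue is UNIFORM EXPONENTIAL STABILITY ALONG
ADMISSIBLE ORBITS: `Markov.OrbitStability A S C θ γ` — for every admissible coupling sequence `g`, every starting step `i` and length `n`, the composite
of the steps `i, …, i+n−1` is `Cθ^n`-Lipschitz on the invariant set.  This file shows that EVERYTHING in `AutonomousScheme` §2 goes through under this
weaker hypothesis, with constants multiplied by `C` and NO loss in the rate:
* §1 `iter A g i n` (the composite of steps `i, …, i+n−1` along `g`), `state_eq_iter`, `iter_congr`, `iter_mem`; the shape `OrbitStability`;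
  `orbitStability_of_stateContraction` (one-step contraction = the case `C = 1`).
* §2 `dist_state_shift_le_of_stable` (source of the scale shift `≤ C·D·θ^j`), `scaleShiftRate_of_stable` (`ScaleShiftRate (cr·C·D·θ) θ γ β`),
  `dist_state_le_sum_of_stable` — the two-history modulus `Σ_{i≤j} C·ℓ·θ^{j−i}|g_i − g′_i|` by a HYBRID (one-coupling-at-a-time) telescoping instead of the
  one-step induction —, `histLipschitz_of_stable`, `fadingMemory_of_stable`, `ne4_of_stable`, `injectedRate_of_stable` (node U2's output by name; the only
  smallness left is the AF-weight one, now `cr·C·ℓ·((k₀+1)γ³ + 2γ∕b) ≤ (1−θ)∕2`).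
* §3 `orbitStability_of_cocycleBound`: for schemes AFFINE in the state (`affineOp T s`), `OrbitStability` IS `T4SpectralRenewal.CocycleBound` of the linear
  parts along admissible coupling sequences (`iter_affineOp_sub`: orbit differences are transported by `prodStep`) — the analogy is literal; `orbitStability_of_pow_le`:
  for a coupling-INDEPENDENT linear part ONE contracting power `‖T₀^N‖ ≤ θ′^N` suffices (adapted constant `T4SpectralRenewal.Kc`).
So the idea-sized item named in `HOME/ne/NE4.md` §6 (g9 addendum) may be read in its natural strength: a k-uniform metric on ONE state space in which the
ORBITS of Bałaban's k-independent RT ([Balaban1988Convergent] = CMP **119** p. 262) are uniformly exponentially stable off the marginal direction — equivalently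
(standard re-metrisation `d′ = sup_w θ^{−|w|} d(A_w ·, A_w ·)`, not typed here) one-step contraction in an EQUIVALENT metric.  NOT PRINTED for non-abelian YM₄ in any
form.  PRINTED TEMPLATE in Bałaban's OWN block-averaging formalism, for SUPERRENORMALIZABLE models (no marginal coupling, no history-dependent β): J. Dimock, *The
renormalization group according to Balaban, I. Small fields*, Rev. Math. Phys. **25** (2013) 1330010 (arXiv:1108.1335), p. 3 «we avoid perturbation theory entirely and
use a dynamical systems approach to renormalization», pp. 22–23: the flow `(μ_k, E_k)` rewritten «contractive», `E_k` in Banach spaces with k-rescaled weights, «By the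
standard fixed point theorem in a complete metric space it suffices to show that the mapping is a contraction … ‖T(ξ₁) − T(ξ₂)‖ ≤ ½‖ξ₁ − ξ₂‖» (relevant couplings by FINAL
conditions, irrelevant data by `E₀ = 0` — the cell's tuned two-point structure); and for ABELIAN gauge fields with fermions in d = 3: J. Dimock, *Stability for QED in
d = 3: an overview* (arXiv:2204.07201), p. 14 «a problem in discrete dynamical systems … a fixed point problem in a Banach space of sequences {ε_k, m_k, E_k}» (Thm 2).
Cited as TEMPLATES only (cell census `HOME/ne/NE4.md` §5 (R42) literature locus); nothing of theirs is used or asserted here.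
-/

namespace Summit.QuantumFields.BalabanUV.T4Continuum.Spine.NE4

open Literature.MathematicalPhysics.QuantumFieldTheory.Balaban1983to89
open Literature.MathematicalPhysics.QuantumFieldTheory.Balaban1983to89.FlowStep
open Literature.MathematicalPhysics.QuantumFieldTheory.Balaban1983to89.T4CouplingMatching
  (ScaleShiftRate HistLipschitz FadingMemory EventualLowerH disc)
open Literature.MathematicalPhysics.QuantumFieldTheory.Balaban1983to89.T4FlagMemory
  (extd extd_coe extd_adm extd_tail tail_mem_box Adm fadingMemory_profile)
open Finset

namespace Markov

/-! ## §1 Composites along a coupling sequence; uniform exponential stability along admissible orbits -/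

section Iter

variable {X : Type*}

/-- The COMPOSITE of the steps `i, i+1, …, i+n−1` of the scheme along the coupling sequence `g` (`iter A g i 0 = id`). [folklore] -/
def iter (A : ℝ → X → X) (g : ℕ → ℝ) (i : ℕ) : ℕ → X → X
  | 0 => fun x => x
  | n + 1 => fun x => A (g (i + n)) (iter A g i n x)

/-- [bookkeeping] zero steps. [folklore] -/
@[simp] theorem iter_zero (A : ℝ → X → X) (g : ℕ → ℝ) (i : ℕ) (x : X) : iter A g i 0 x = x := rfl

/-- [bookkeeping] one more step. [folklore] -/
@[simp] theorem iter_succ (A : ℝ → X → X) (g : ℕ → ℝ) (i n : ℕ) (x : X) :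
    iter A g i (n + 1) x = A (g (i + n)) (iter A g i n x) := rfl

/-- [bookkeeping] THE STATE AFTER `i + n` STEPS IS THE COMPOSITE OF STEPS `i, …, i+n−1` APPLIED TO THE STATE AFTER `i` STEPS. [folklore] -/
theorem state_eq_iter (A : ℝ → X → X) (ξ : X) (g : ℕ → ℝ) (i : ℕ) :
    ∀ n, state A ξ g (i + n) = iter A g i n (state A ξ g i)
  | 0 => rfl
  | n + 1 => by rw [← Nat.add_assoc, state_succ, iter_succ, state_eq_iter A ξ g i n]

/-- [bookkeeping] the composite depends only on the couplings at the steps it uses. [folklore] -/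
theorem iter_congr {A : ℝ → X → X} {g g' : ℕ → ℝ} {i : ℕ} :
    ∀ n, (∀ m, i ≤ m → m < i + n → g m = g' m) → ∀ x, iter A g i n x = iter A g' i n x
  | 0, _, _ => rfl
  | n + 1, h, x => by
    rw [iter_succ, iter_succ, h (i + n) (Nat.le_add_right i n) (by omega),
      iter_congr n (fun m hm hm' => h m hm (by omega)) x]

/-- [bookkeeping] composites along admissible sequences keep the invariant set. [folklore] -/
theorem iter_mem {A : ℝ → X → X} {S : Set X} {γ : ℝ} (hInv : Invariant A S γ) {g : ℕ → ℝ} (hg : Adm γ g) (i : ℕ) :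
    ∀ n, ∀ x ∈ S, iter A g i n x ∈ S
  | 0, _, hx => hx
  | n + 1, x, hx => hInv _ (hg (i + n)).1 (hg (i + n)).2 _ (iter_mem hInv hg i n x hx)

end Iter

section Shapes

variable {X : Type*} [PseudoMetricSpace X]

/-- [shape] HYPOTHESIS SHAPE (NOT PRINTED in any form): **UNIFORM EXPONENTIAL STABILITY ALONG ADMISSIBLE ORBITS** — for every admissible coupling
sequence, every starting step `i` and every length `n`, the composite of the steps `i, …, i+n−1` is `C·θ^n`-Lipschitz on the invariant set.  The
nonlinear, autonomous analogue of `T4SpectralRenewal.CocycleBound` (there: the linearised transfer); one-step contraction is the case `C = 1`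
(`orbitStability_of_stateContraction`).  NOT a fact. [folklore] -/
def OrbitStability (A : ℝ → X → X) (S : Set X) (C θ γ : ℝ) : Prop :=
  ∀ g : ℕ → ℝ, Adm γ g → ∀ i n, ∀ x ∈ S, ∀ y ∈ S, dist (iter A g i n x) (iter A g i n y) ≤ C * θ ^ n * dist x y

/-- [bookkeeping] ONE-STEP CONTRACTION IS THE CASE `C = 1`: `StateContraction A S θ γ` + `Invariant A S γ` ⇒ `OrbitStability A S 1 θ γ`. [folklore] -/
theorem orbitStability_of_stateContraction {A : ℝ → X → X} {S : Set X} {θ γ : ℝ} (hθ : 0 ≤ θ)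
    (hInv : Invariant A S γ) (hcon : StateContraction A S θ γ) : OrbitStability A S 1 θ γ := by
  intro g hg i n
  induction n with
  | zero => intro x _ y _; simp
  | succ n ih =>
    intro x hx y hy
    rw [iter_succ, iter_succ]
    calc dist (A (g (i + n)) (iter A g i n x)) (A (g (i + n)) (iter A g i n y))
        ≤ θ * dist (iter A g i n x) (iter A g i n y) :=
          hcon _ (hg (i + n)).1 (hg (i + n)).2 _ (iter_mem hInv hg i n x hx) _ (iter_mem hInv hg i n y hy)
      _ ≤ θ * (1 * θ ^ n * dist x y) := mul_le_mul_of_nonneg_left (ih x hx y hy) hθ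
      _ = 1 * θ ^ (n + 1) * dist x y := by ring

end Shapes

/-! ## §2 Kernel under orbit stability: scale shift, two-history modulus by hybrids, node U2's inputs and output -/

section Kernel

variable {X : Type*} [PseudoMetricSpace X] {A : ℝ → X → X} {S : Set X} {ξ : X} {r : X → ℝ} {β : HBeta}
  {C θ ℓ D γ cr : ℝ}

/-- **THE SOURCE OF THE SCALE SHIFT UNDER ORBIT STABILITY**: run B after `j + 1` steps and run A after `j` steps have applied the SAME composite
(steps `1, …, j` of run B's couplings) to `A (g 0) ξ` resp. `ξ`, so they are `C·D·θ^j`-close. [folklore] -/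
theorem dist_state_shift_le_of_stable (hInv : Invariant A S γ) (hξ : ξ ∈ S)
    (hst : OrbitStability A S C θ γ) (hfirst : FirstStep A ξ D γ) (hC : 0 ≤ C) (hθ : 0 ≤ θ) {g : ℕ → ℝ} (hg : Adm γ g) (j : ℕ) :
    dist (state A ξ g (j + 1)) (state A ξ (fun m => g (m + 1)) j) ≤ C * D * θ ^ j := by
  have hB : state A ξ g (j + 1) = iter A (fun m => g (m + 1)) 0 j (A (g 0) ξ) := by
    have e := state_eq_iter A ξ g 1 j
    rw [Nat.add_comm] at e
    rw [e]
    show iter A g 1 j (A (g 0) ξ) = _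
    -- the composite of steps 1..j along `g` is the composite of steps 0..j-1 along the shifted sequence
    have key : ∀ n x, iter A g 1 n x = iter A (fun m => g (m + 1)) 0 n x := by
      intro n
      induction n with
      | zero => intro x; rfl
      | succ n ih => intro x; rw [iter_succ, iter_succ, ih, Nat.zero_add, Nat.add_comm]
    exact key j _
  have hA : state A ξ (fun m => g (m + 1)) j = iter A (fun m => g (m + 1)) 0 j ξ := by
    simpa using state_eq_iter A ξ (fun m => g (m + 1)) 0 j
  rw [hB, hA]
  calc dist (iter A (fun m => g (m + 1)) 0 j (A (g 0) ξ)) (iter A (fun m => g (m + 1)) 0 j ξ)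
      ≤ C * θ ^ j * dist (A (g 0) ξ) ξ :=
        hst _ (adm_shift hg) 0 j _ (hInv _ (hg 0).1 (hg 0).2 _ hξ) _ hξ
    _ ≤ C * θ ^ j * D := mul_le_mul_of_nonneg_left (hfirst _ (hg 0).1 (hg 0).2) (mul_nonneg hC (pow_nonneg hθ _))
    _ = C * D * θ ^ j := by ring

/-- **NE4 UNDER ORBIT STABILITY**: `ScaleShiftRate (cr·C·D·θ) θ γ β` — the rate is still `θ` itself; only the constant carries `C`. [folklore] -/
theorem scaleShiftRate_of_stable (hInv : Invariant A S γ) (hξ : ξ ∈ S) (hst : OrbitStability A S C θ γ)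
    (hfirst : FirstStep A ξ D γ) (hC : 0 ≤ C) (hθ : 0 ≤ θ) (hcr : 0 ≤ cr)
    (hrep : RepresentsAut A r ξ γ β) (hr : ReadLipschitzOn r S cr) :
    ScaleShiftRate (cr * C * D * θ) θ γ β := by
  intro k w hw
  rw [hrep (k + 1) w hw, hrep k (Fin.tail w) (tail_mem_box hw), extd_tail]
  have h := dist_state_shift_le_of_stable hInv hξ hst hfirst hC hθ (extd_adm hw) (k + 1)
  calc |r (state A ξ (extd w) (k + 1 + 1)) - r (state A ξ (fun m => extd w (m + 1)) (k + 1))|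
      ≤ cr * dist (state A ξ (extd w) (k + 1 + 1)) (state A ξ (fun m => extd w (m + 1)) (k + 1)) :=
        hr _ (state_mem hInv hξ (extd_adm hw) _) _ (state_mem hInv hξ (adm_shift (extd_adm hw)) _)
    _ ≤ cr * (C * D * θ ^ (k + 1)) := mul_le_mul_of_nonneg_left h hcr
    _ = cr * C * D * θ * θ ^ k := by ring

/-- The HYBRID coupling sequences: `g` before step `i`, `g′` from step `i` on. [folklore] -/
def hybrid (g g' : ℕ → ℝ) (i : ℕ) : ℕ → ℝ := fun m => if m < i then g m else g' m

/-- [bookkeeping] hybrids of admissible sequences are admissible. [folklore] -/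
theorem adm_hybrid {g g' : ℕ → ℝ} (hg : Adm γ g) (hg' : Adm γ g') (i : ℕ) : Adm γ (hybrid g g' i) := fun m => by
  unfold hybrid; split_ifs
  · exact hg m
  · exact hg' m

omit [PseudoMetricSpace X] in
/-- [bookkeeping] consecutive hybrids share the state after `i` steps (both follow `g` there). [folklore] -/
theorem state_hybrid_succ_eq (g g' : ℕ → ℝ) (i : ℕ) :
    state A ξ (hybrid g g' (i + 1)) i = state A ξ (hybrid g g' i) i :=
  state_congr i fun m hm => by simp [hybrid, hm, Nat.lt_succ_of_lt hm]

/-- [bookkeeping] ONE COUPLING CHANGED: consecutive hybrids differ only at step `i` (price `ℓ`), and the later steps `i+1, …, j` (all along `g′`)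
propagate that difference with the orbit-stability factor `C·θ^{j−i}`. [folklore] -/
theorem dist_state_hybrid_step (hInv : Invariant A S γ) (hξ : ξ ∈ S) (hst : OrbitStability A S C θ γ)
    (hlip : StateCouplingLipschitz A S ℓ γ) (hC : 0 ≤ C) (hθ : 0 ≤ θ)
    {g g' : ℕ → ℝ} (hg : Adm γ g) (hg' : Adm γ g') {i j : ℕ} (hij : i ≤ j) :
    dist (state A ξ (hybrid g g' (i + 1)) (j + 1)) (state A ξ (hybrid g g' i) (j + 1))
      ≤ C * ℓ * θ ^ (j - i) * |g i - g' i| := by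
  obtain ⟨n, rfl⟩ : ∃ n, j = i + n := ⟨j - i, by omega⟩
  rw [Nat.add_sub_cancel_left]
  have h1 := adm_hybrid hg hg' (i + 1)
  have h0 := adm_hybrid hg hg' i
  -- states after i+1 steps: A (g i) x_i and A (g' i) x_i
  have ex1 : state A ξ (hybrid g g' (i + 1)) (i + 1) = A (g i) (state A ξ (hybrid g g' i) i) := by
    rw [state_succ, state_hybrid_succ_eq]; simp [hybrid]
  have ex0 : state A ξ (hybrid g g' i) (i + 1) = A (g' i) (state A ξ (hybrid g g' i) i) := by
    rw [state_succ]; simp [hybrid]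
  have hxi : state A ξ (hybrid g g' i) i ∈ S := state_mem hInv hξ h0 i
  -- the later composites coincide (both along g′ at steps ≥ i+1)
  have e1 : state A ξ (hybrid g g' (i + 1)) (i + n + 1) =
      iter A (hybrid g g' (i + 1)) (i + 1) n (state A ξ (hybrid g g' (i + 1)) (i + 1)) := by
    rw [show i + n + 1 = (i + 1) + n by omega]; exact state_eq_iter A ξ _ (i + 1) n
  have e0 : state A ξ (hybrid g g' i) (i + n + 1) =
      iter A (hybrid g g' (i + 1)) (i + 1) n (state A ξ (hybrid g g' i) (i + 1)) := by
    rw [show i + n + 1 = (i + 1) + n by omega, state_eq_iter A ξ _ (i + 1) n]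
    exact iter_congr n (fun m hm _ => by simp [hybrid, show ¬ m < i by omega, show ¬ m < i + 1 by omega]) _
  rw [e1, e0, ex1, ex0]
  have hm1 : A (g i) (state A ξ (hybrid g g' i) i) ∈ S := hInv _ (hg i).1 (hg i).2 _ hxi
  have hm0 : A (g' i) (state A ξ (hybrid g g' i) i) ∈ S := hInv _ (hg' i).1 (hg' i).2 _ hxi
  calc dist (iter A (hybrid g g' (i + 1)) (i + 1) n (A (g i) (state A ξ (hybrid g g' i) i)))
        (iter A (hybrid g g' (i + 1)) (i + 1) n (A (g' i) (state A ξ (hybrid g g' i) i)))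
      ≤ C * θ ^ n * dist (A (g i) (state A ξ (hybrid g g' i) i)) (A (g' i) (state A ξ (hybrid g g' i) i)) :=
        hst _ h1 (i + 1) n _ hm1 _ hm0
    _ ≤ C * θ ^ n * (ℓ * |g i - g' i|) :=
        mul_le_mul_of_nonneg_left (hlip _ _ (hg i).1 (hg i).2 (hg' i).1 (hg' i).2 _ hxi) (mul_nonneg hC (pow_nonneg hθ _))
    _ = C * ℓ * θ ^ n * |g i - g' i| := by ring

/-- **TWO-HISTORY MODULUS UNDER ORBIT STABILITY (hybrid telescoping).**  For admissible `g, g′`: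
`dist (state g (j+1)) (state g′ (j+1)) ≤ Σ_{i≤j} C·ℓ·θ^{j−i}·|g_i − g′_i|` — change one coupling at a time (`hybrid g g′ i`, `i = 0, …, j+1`) and sum
the one-coupling prices of `dist_state_hybrid_step` (`dist_le_range_sum_dist`). [folklore] -/
theorem dist_state_le_sum_of_stable (hInv : Invariant A S γ) (hξ : ξ ∈ S) (hst : OrbitStability A S C θ γ)
    (hlip : StateCouplingLipschitz A S ℓ γ) (hC : 0 ≤ C) (hθ : 0 ≤ θ)
    {g g' : ℕ → ℝ} (hg : Adm γ g) (hg' : Adm γ g') (j : ℕ) :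
    dist (state A ξ g (j + 1)) (state A ξ g' (j + 1)) ≤ ∑ i ∈ range (j + 1), C * ℓ * θ ^ (j - i) * |g i - g' i| := by
  -- the chain of hybrids from g′ (i = 0) to g (i = j+1), evaluated after j+1 steps
  let f : ℕ → X := fun i => state A ξ (hybrid g g' i) (j + 1)
  have hf0 : f 0 = state A ξ g' (j + 1) := state_congr (j + 1) fun m _ => by simp [hybrid]
  have hfe : f (j + 1) = state A ξ g (j + 1) := state_congr (j + 1) fun m hm => by simp [hybrid, hm]
  rw [← hf0, ← hfe, dist_comm]
  calc dist (f 0) (f (j + 1)) ≤ ∑ i ∈ range (j + 1), dist (f i) (f (i + 1)) := dist_le_range_sum_dist f (j + 1)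
    _ ≤ ∑ i ∈ range (j + 1), C * ℓ * θ ^ (j - i) * |g i - g' i| := by
        refine Finset.sum_le_sum fun i hi => ?_
        rw [dist_comm]
        exact dist_state_hybrid_step hInv hξ hst hlip hC hθ hg hg' (Nat.lt_succ_iff.mp (mem_range.mp hi))

/-- **NODE U2's HISTORY MODULI UNDER ORBIT STABILITY**: `HistLipschitz (fun k i ↦ cr·C·ℓ·θ^{k−i}) γ β`. [folklore] -/
theorem histLipschitz_of_stable (hInv : Invariant A S γ) (hξ : ξ ∈ S) (hst : OrbitStability A S C θ γ)
    (hlip : StateCouplingLipschitz A S ℓ γ) (hC : 0 ≤ C) (hθ : 0 ≤ θ) (hcr : 0 ≤ cr)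
    (hrep : RepresentsAut A r ξ γ β) (hr : ReadLipschitzOn r S cr) :
    HistLipschitz (fun k i => cr * C * ℓ * θ ^ (k - i)) γ β := by
  intro k p q hp hq
  rw [hrep k p hp, hrep k q hq]
  have h := dist_state_le_sum_of_stable hInv hξ hst hlip hC hθ (extd_adm hp) (extd_adm hq) k
  have e : ∑ i : Fin (k + 1), cr * C * ℓ * θ ^ (k - (i : ℕ)) * |p i - q i|
      = cr * ∑ i ∈ range (k + 1), C * ℓ * θ ^ (k - i) * |extd p i - extd q i| := by
    rw [Finset.mul_sum, ← Fin.sum_univ_eq_sum_range]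
    refine Finset.sum_congr rfl fun i _ => ?_
    rw [extd_coe, extd_coe]
    ring
  calc |r (state A ξ (extd p) (k + 1)) - r (state A ξ (extd q) (k + 1))|
      ≤ cr * dist (state A ξ (extd p) (k + 1)) (state A ξ (extd q) (k + 1)) :=
        hr _ (state_mem hInv hξ (extd_adm hp) _) _ (state_mem hInv hξ (extd_adm hq) _)
    _ ≤ cr * ∑ i ∈ range (k + 1), C * ℓ * θ ^ (k - i) * |extd p i - extd q i| := mul_le_mul_of_nonneg_left h hcr
    _ = ∑ i : Fin (k + 1), cr * C * ℓ * θ ^ (k - (i : ℕ)) * |p i - q i| := e.symm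

/-- The delivered moduli fade at the rate `θ` — no loss in the rate, constant `cr·C·ℓ`. [folklore] -/
theorem fadingMemory_of_stable (hθ : 0 ≤ θ) (hcr : 0 ≤ cr) (hC : 0 ≤ C) (hℓ : 0 ≤ ℓ) :
    FadingMemory (cr * C * ℓ) θ (fun k i => cr * C * ℓ * θ ^ (k - i)) :=
  fadingMemory_profile (mul_nonneg (mul_nonneg hcr hC) hℓ) hθ

/-- **NE4 FOR A β-FAMILY GENERATED BY A UNIFORMLY EXPONENTIALLY STABLE AUTONOMOUS SCHEME — node U2's triple with ONE rate `θ`.**  `AutonomousScheme`'s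
`ne4_of_markov` is the case `C = 1`.  HYPOTHESES ONLY about the scheme. [folklore] -/
theorem ne4_of_stable (hInv : Invariant A S γ) (hξ : ξ ∈ S) (hst : OrbitStability A S C θ γ)
    (hlip : StateCouplingLipschitz A S ℓ γ) (hfirst : FirstStep A ξ D γ) (hC : 0 ≤ C) (hθ : 0 ≤ θ) (hcr : 0 ≤ cr) (hℓ : 0 ≤ ℓ)
    (hrep : RepresentsAut A r ξ γ β) (hr : ReadLipschitzOn r S cr) :
    ScaleShiftRate (cr * C * D * θ) θ γ β ∧
    HistLipschitz (fun k i => cr * C * ℓ * θ ^ (k - i)) γ β ∧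
    FadingMemory (cr * C * ℓ) θ (fun k i => cr * C * ℓ * θ ^ (k - i)) :=
  ⟨scaleShiftRate_of_stable hInv hξ hst hfirst hC hθ hcr hrep hr,
   histLipschitz_of_stable hInv hξ hst hlip hC hθ hcr hrep hr,
   fadingMemory_of_stable hθ hcr hC hℓ⟩

/-- **NODE U2's OUTPUT UNDER ORBIT STABILITY** (composition with `T4CouplingMatching.injectedRate_of_runs_eventual`): for IR-pinned runs of the printed
recursion (0.20) in ]0,γ], an eventual lower bound `b ≤ β` from scale `k₀`, `0 < θ < 1`, and the AF-weight smallness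
`cr·C·ℓ·((k₀+1)γ³ + 2γ∕b) ≤ (1−θ)∕2`: `InjectedRate (2·cr·C·D·θ∕(1−θ)) 0 θ`.  Bookkeeping over UNPRINTED inputs. [folklore] -/
theorem injectedRate_of_stable {b : ℝ} {k₀ : ℕ} (g : ℕ → ℕ → ℝ) (gIR : ℝ)
    (hγ : 0 < γ) (hb : 0 < b) (hθ0 : 0 < θ) (hθ1 : θ < 1) (hC : 0 ≤ C) (hcr : 0 ≤ cr) (hℓ : 0 ≤ ℓ) (hD : 0 ≤ D)
    (hInv : Invariant A S γ) (hξ : ξ ∈ S) (hst : OrbitStability A S C θ γ)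
    (hlip : StateCouplingLipschitz A S ℓ γ) (hfirst : FirstStep A ξ D γ)
    (hrep : RepresentsAut A r ξ γ β) (hr : ReadLipschitzOn r S cr)
    (hrun : ∀ K, RGEqH K β (g K)) (hbox : ∀ K i, i ≤ K → 0 < g K i ∧ g K i ≤ γ)
    (hpin : ∀ K, g K K = gIR) (hlo : EventualLowerH b γ k₀ β)
    (hsmall : cr * C * ℓ * (((k₀ : ℝ) + 1) * γ ^ 3 + 2 * γ / b) ≤ (1 - θ) / 2) :
    T4CauchySum.InjectedRate (2 * (cr * C * D * θ) / (1 - θ)) 0 θ (fun K j => disc (g K) (g (K + 1)) j) := by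
  obtain ⟨hS, hL, hΛ⟩ := ne4_of_stable hInv hξ hst hlip hfirst hC hθ0.le hcr hℓ hrep hr
  exact T4CouplingMatching.injectedRate_of_runs_eventual g gIR hγ hb hθ0 hθ1
    (mul_nonneg (mul_nonneg (mul_nonneg hcr hC) hD) hθ0.le) (mul_nonneg (mul_nonneg hcr hC) hℓ) hrun hbox hpin hS hL hΛ hlo hsmall

end Kernel

/-! ## §3 The bridge to `T4SpectralRenewal`: for schemes AFFINE in the state, orbit stability IS the cocycle bound of the linear parts -/

section Affine

variable {E : Type*} [NormedAddCommGroup E] [NormedSpace ℝ E]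

/-- An AFFINE-IN-THE-STATE scheme on a normed space: linear part `T g` and source `s g` per coupling (the shape of the cell's linear toy
models, e.g. `T4FlagMemory.linStep`, `Support/NE4TransferModel`'s transfer). [folklore] -/
def affineOp (T : ℝ → E →L[ℝ] E) (s : ℝ → E) : ℝ → E → E := fun g x => T g x + s g

/-- [bookkeeping] Along any coupling sequence the difference of two orbits of an affine scheme is transported by the ORDERED PRODUCT of the linear
parts — `T4SpectralRenewal.prodStep`. [folklore] -/
theorem iter_affineOp_sub (T : ℝ → E →L[ℝ] E) (s : ℝ → E) (g : ℕ → ℝ) (i : ℕ) :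
    ∀ n (x y : E), iter (affineOp T s) g i n x - iter (affineOp T s) g i n y =
      T4SpectralRenewal.prodStep (fun k => T (g k)) i n (x - y)
  | 0, x, y => by simp
  | n + 1, x, y => by
    rw [iter_succ, iter_succ, T4SpectralRenewal.prodStep_succ]
    change _ = T (g (i + n)) (T4SpectralRenewal.prodStep (fun k => T (g k)) i n (x - y))
    rw [← iter_affineOp_sub T s g i n x y, map_sub]
    simp only [affineOp]
    abel

/-- **ORBIT STABILITY OF AN AFFINE SCHEME = THE COCYCLE BOUND OF ITS LINEAR PARTS** (`T4SpectralRenewal.CocycleBound`, the located sharp form of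
node U2's memory input, cell GAPS G-t4-U2R2-2): if along every admissible coupling sequence the linear parts satisfy `CocycleBound C θ`, the affine
scheme has `OrbitStability _ S C θ γ` on any set `S`.  So for the cell's linear(ised) models (R42)(e)'s hypothesis is literally the cocycle
hypothesis of `T4SpectralRenewal` — per-step contraction not required, per-step spectral data not sufficient (its §4 hazard). [folklore] -/
theorem orbitStability_of_cocycleBound {T : ℝ → E →L[ℝ] E} {s : ℝ → E} {C θ γ : ℝ} (S : Set E)
    (h : ∀ g : ℕ → ℝ, Adm γ g → T4SpectralRenewal.CocycleBound C θ (fun k => T (g k))) :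
    OrbitStability (affineOp T s) S C θ γ := by
  intro g hg i n x _ y _
  rw [dist_eq_norm, iter_affineOp_sub, dist_eq_norm]
  exact (ContinuousLinearMap.le_opNorm _ _).trans (mul_le_mul_of_nonneg_right (h g hg i n) (norm_nonneg _))

/-- **COUPLING-INDEPENDENT LINEAR PART: ONE CONTRACTING POWER SUFFICES.**  If the linear part does not depend on the coupling (`T g = T₀`) and ONE power contracts,
`‖T₀ ^ N‖ ≤ θ′ ^ N` (`N ≥ 1`, `θ′ > 0` — in a complex Banach algebra available for every `θ′` above the spectral radius, Gelfand), then the affine scheme is orbit-stable at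
rate `θ′` with the ADAPTED constant `T4SpectralRenewal.Kc T₀ θ′ N` (`T4SpectralRenewal.powerBound_of_pow_le` + `cocycleBound_const_iff`).  Contrast `T4SpectralRenewal` §4: for
COUPLING-DEPENDENT linear parts, per-step spectral data do NOT suffice — the cocycle bound itself is the hypothesis. [folklore] -/
theorem orbitStability_of_pow_le {T₀ : E →L[ℝ] E} {s : ℝ → E} {θ' γ : ℝ} {N : ℕ} (S : Set E) (hθ : 0 < θ') (hN : 1 ≤ N)
    (h : ‖T₀ ^ N‖ ≤ θ' ^ N) : OrbitStability (affineOp (fun _ => T₀) s) S (T4SpectralRenewal.Kc T₀ θ' N) θ' γ :=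
  orbitStability_of_cocycleBound S fun _ _ =>
    (T4SpectralRenewal.cocycleBound_const_iff.mpr (T4SpectralRenewal.powerBound_of_pow_le hθ hN h))

end Affine

end Markov

end Summit.QuantumFields.BalabanUV.T4Continuum.Spine.NE4
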